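/-
Copyright (c) 2026. All rights reserved.
Released under Apache 2.0 license as described in the file LICENSE.
Authors: abc-iut cell, prover seat abc-iut-w5-d017 (wave 5, gen 6).
-/
import Summits.ABC.IUTFork.Cor312Ind3IteratesVacuityRamificationCriterion
import Literature.IUT.LogVolume.UnitLogDyadicRootsOfUnity
import HarnessLib

/-!
# (Ind3) honest iterates at DYADIC places with `f(v|2) = 1`: `ζ_{2^{j+2}} ∈ F`, `2^{j+3} ∤ e(v|2)` ⇒ empty

Proof-only sequel (theorems, no definitions) of `Cor312Ind3IteratesVacuityDyadicPowerCriterion.lean` (abc-iut-w5-d017: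
`√−1 ∈ F`, `f(v|2) = 1`, `8 ∤ e(v|2)` ⇒ every honest depth-`≥ 2` image is empty), transporting the roots-of-unity
descent `Literature.IUT.LogVolume.RamificationCriterion.norm_unitLog_ne_one_of_pow_two_pow_eq_neg_one`
(`UnitLogDyadicRootsOfUnity.lean`) to the completions `F_v` (abc-iut-S7: `e(F_v) = e(v|2)`, `f(F_v) = f(v|2)`):

* `Real.nonarchIterImage_add_two_eq_empty_of_pow_two_pow_eq_neg_one` — **`ζ^{2^{j+1}} = −1` in `F` (a primitive
  `2^{j+2}`-th root of unity), `v ∣ 2`, `f(v|2) = 1`, `2^{j+3} ∤ e(v|2)` ⇒ every honest depth-`≥ 2` image at `v`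
  is EMPTY** (`j = 0`: `√−1`, `8 ∤ e`; `j = 1`: `ζ₈ ∈ F`, `16 ∤ e`; `j = 2`: `ζ₁₆ ∈ F`, `32 ∤ e`);
* packet-level form `tprodImages_honestU_add_two_eq_empty_of_pow_two_pow_eq_neg_one`.

Census consequence (kernel, `f(v|2) = 1`, `F ∋ √−1` as in [IUTchI] Def 3.1): with `2^{j+2}` the number of `2`-power
roots of unity in `F` mapped to `F_v`, `2^{j+3} ∤ e(v|2)` ⇒ empty; when `2^{j+3} ∣ e(v|2)` the answer is field-dependent
(abc-iut-S1: `ℚ₂(⁸√−25)` inhabited vs `ℚ₂(ζ₁₆)` empty at `(8, 1)`).  Honest framing: statements ABOUT THE MODEL;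
nothing here asserts or denies [IUTchIII] Cor. 3.12 or takes a side; census ≠ verdict; typed ≠ proved.  No
definitions, no Prop-valued fact (D-0067 (1)).
-/

noncomputable section

open Set

namespace Summit.ABC.IUTFork.Thm311.Real

open NumberField IsDedekindDomain Literature.IUT.LogVolume Literature.IUT.LogThetaLattice
  Literature.NumberTheory.NumberFields

variable {F : Type} [Field F] [NumberField F]

/-- Local step: `ζ^{2^{j+1}} = −1` in `F`, a place over `p = 2` with `f(v|2) = 1`, `2^{j+3} ∤ e(v|2)` ⇒ the
`2`-adic logarithm of no element of `F_v` has rescaled norm `1`. [cite: NeukirchANT1999, Ch. II (5.5)] -/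
theorem norm_unitLog_rescaled_ne_one_of_pow_two_pow_eq_neg_one (v : HeightOneSpectrum (𝓞 F)) (p : ℕ)
    [Fact p.Prime] (hv : ((p : ℕ) : 𝓞 F) ∈ v.asIdeal) (hp2 : p = 2) {ζ : F} {j : ℕ}
    (hζ : ζ ^ (2 ^ (j + 1)) = -1) (he : ¬ 2 ^ (j + 3) ∣ v.asIdeal.ramificationIdx ℤ)
    (hf : v.asIdeal.inertiaDeg ℤ = 1) (y : RescaledCompletion F p v hv) : ‖unitLog y‖ ≠ 1 := by
  subst hp2
  have he' : ¬ 2 ^ (j + 3) ∣ absRamificationIdx 2 (RescaledCompletion F 2 v hv) := by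
    rw [absRamificationIdx_rescaledCompletion]; exact he
  have hf' : residueDegree 2 (RescaledCompletion F 2 v hv) = 1 := by
    rw [residueDegree_rescaledCompletion, hf]
  have hζv : (RescaledCompletion.of F 2 v hv (algebraMap F (v.adicCompletion F) ζ)) ^ (2 ^ (j + 1)) = -1 := by
    rw [← map_pow, ← map_pow, hζ, map_neg, map_one, map_neg, map_one]
  exact RamificationCriterion.norm_unitLog_ne_one_of_pow_two_pow_eq_neg_one hf' hζv he' y

/-- **`ζ^{2^{j+1}} = −1` in `F`, `v ∣ 2`, `f(v|2) = 1`, `2^{j+3} ∤ e(v|2)`: `‖log_v(w)‖' ≠ 1` for every unit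
`w ∈ O_v^×`.** [cite: NeukirchANT1999, Ch. II (5.5)] -/
theorem norm_of_analyticLogv_ne_one_of_pow_two_pow_eq_neg_one (v : HeightOneSpectrum (𝓞 F))
    (h2 : residueChar F v = 2) {ζ : F} {j : ℕ} (hζ : ζ ^ (2 ^ (j + 1)) = -1)
    (he : ¬ 2 ^ (j + 3) ∣ v.asIdeal.ramificationIdx ℤ) (hf : v.asIdeal.inertiaDeg ℤ = 1) (w : (↥(integers v))ˣ) :
    ‖RescaledCompletion.of F (residueChar F v) v (natCast_residueChar_mem F v)
        (analyticLogv F v (Additive.ofMul w))‖ ≠ 1 := by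
  haveI : Fact (residueChar F v).Prime := ⟨residueChar_prime F v⟩
  rw [analyticLogv_apply, RingEquiv.apply_symm_apply]
  exact norm_unitLog_rescaled_ne_one_of_pow_two_pow_eq_neg_one v (residueChar F v)
    (natCast_residueChar_mem F v) h2 hζ he hf _

/-- **`ζ^{2^{j+1}} = −1` in `F` ⇒ every honest (Ind3) iterate image of depth `m′ + 2` at a place `v ∣ 2` with
`f(v|2) = 1`, `2^{j+3} ∤ e(v|2)` is EMPTY** (`ζ₈ ∈ F`: `e(v|2) = 8` is covered).
[claim: Mochizuki2012, status: disputed] -/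
theorem nonarchIterImage_add_two_eq_empty_of_pow_two_pow_eq_neg_one (v : HeightOneSpectrum (𝓞 F))
    (h2 : residueChar F v = 2) {ζ : F} {j : ℕ} (hζ : ζ ^ (2 ^ (j + 1)) = -1)
    (he : ¬ 2 ^ (j + 3) ∣ v.asIdeal.ramificationIdx ℤ) (hf : v.asIdeal.inertiaDeg ℤ = 1) (m : ℕ) :
    nonarchIterImage (analyticLogv F) v (m + 2) = ∅ := by
  ext z
  simp only [mem_empty_iff_false, iff_false]
  rintro ⟨u, hu, -⟩
  obtain ⟨w, hw⟩ := nonarchIterImage_succ_subset_range (analyticLogv F) v m hu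
  have h1 := norm_of_analyticLogv_ne_one_of_pow_two_pow_eq_neg_one v h2 hζ he hf w
  dsimp only at hw
  rw [hw] at h1
  exact h1 (norm_of_coe_unit_adicCompletionIntegers F (residueChar F v) v (natCast_residueChar_mem F v) u)

/-- The per-place honest family at depth `≥ 2` is empty there. [claim: Mochizuki2012, status: disputed] -/
theorem iterImage_add_two_inr_eq_empty_of_pow_two_pow_eq_neg_one (v : HeightOneSpectrum (𝓞 F))
    (h2 : residueChar F v = 2) {ζ : F} {j : ℕ} (hζ : ζ ^ (2 ^ (j + 1)) = -1)
    (he : ¬ 2 ^ (j + 3) ∣ v.asIdeal.ramificationIdx ℤ) (hf : v.asIdeal.inertiaDeg ℤ = 1) (m : ℕ) :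
    iterImage (analyticLogv F) (m + 2) (.inr v : Place F) = ∅ :=
  nonarchIterImage_add_two_eq_empty_of_pow_two_pow_eq_neg_one v h2 hζ he hf m

/-- **Packet level**: `ζ^{2^{j+1}} = −1` in `F` ⇒ the pure-tensor unit image of the honest components at depth
`m′ + 2` is EMPTY at `v_ℚ = 2` over which some place `w` of `F` has `f(w|2) = 1`, `2^{j+3} ∤ e(w|2)`.
[claim: Mochizuki2012, status: disputed] -/
theorem tprodImages_honestU_add_two_eq_empty_of_pow_two_pow_eq_neg_one (X : PilotData F) (m : ℤ) (n : ℕ)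
    (j' : (thetaIndex X).Label) {vQ : (thetaIndex X).VQ}
    (w : HeightOneSpectrum (𝓞 F)) (hw : (thetaIndex X).over (.inr w) = vQ)
    (h2 : residueChar F w = 2) {ζ : F} {j : ℕ} (hζ : ζ ^ (2 ^ (j + 1)) = -1)
    (he : ¬ 2 ^ (j + 3) ∣ w.asIdeal.ramificationIdx ℤ) (hf : w.asIdeal.inertiaDeg ℤ = 1) :
    (logShellsDH X (analyticLogv F)).tprodImages j' vQ (honestU X (analyticLogv F) m (n + 2) vQ) = ∅ :=
  LogShells.tprodImages_eq_empty_of_eq_empty _ j' vQ _ ⟨.inr w, hw⟩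
    (nonarchIterImage_add_two_eq_empty_of_pow_two_pow_eq_neg_one w h2 hζ he hf n)

end Summit.ABC.IUTFork.Thm311.Real

end
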